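import Literature.AlgebraicGeometry.HodgeTheory.CMFieldOneBalancedPlaceHodgeLie
import Literature.AlgebraicGeometry.HodgeTheory.CMHodgeGroupOneBalancedPlaceKWeil
import Literature.AlgebraicGeometry.HodgeTheory.WeilTypeHodgeGroupSemisimpleOfCentre
import HarnessLib

/-!
# `Lie Hg(A) ⊗ ℂ ⊇ (𝔲_E ∩ 𝔰𝔲_K) ⊗ ℂ` for a SIMPLE abelian variety of WEIL TYPE `(3, d)` with `End⁰(A) = E ⊋ K` a sextic CM
# field, CM pattern `(2,2,1)` — TABLE X ROW 13 `g6.IV(3,1).kE0`, EVERY member (Moonen–Zarhin 1998 §4; 1999 (2.3); Ribet 1983)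

Family `hodge`, layer `Literature/AlgebraicGeometry/HodgeTheory` (cell `pub-hodgeav-hg6`, req-37 (A) Q2b, TABLE X ROW 13; eng-3 g3,
job B6 row 13 — the GEOMETRIC reading of `CMThetaOneBalancedKWeil.mem_hodgeLieC_of_commute_of_skew_of_traces`, in the
VERBATIM shape of the displayed Lie hypothesis `hSU_E` of the `E ⊋ K` socket
`IsWeilType.mem_hodgeGroupOne_of_mem_unitaryCentralizerGroup_of_cmField_of_hodgeLieC` (`WeilTypeCMFieldHodgeGroupUEOfLie`)).
UNCONDITIONAL; theorems only, no definition, no named fact, no `sorry`. HONEST FRAMING of that cell: HC ∕ HC_AV ∕ HC_CM ∕ H2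
NOT proved — a statement about `Lie Hg(A)`.

* **`IsWeilType.mem_hodgeLieC_of_commute_of_skew_of_trace_of_cmField`** — DATA: `(A, φ)` of Weil type `(3, d)`, `A` simple,
  `φ_E ∈ End(A)` with `dim_ℚ End⁰(A) = 2|ι|`, `|ι| ≤ 3`, a CM type `μ` of `φ_E^*` with pair multiplicity `2`
  (`n_{μ k} + n_{μ̄ k} = 2`), `dim A = 2|ι|`, ONE balanced place `k₀` (`n_{μ k₀}, n_{μ̄ k₀} ≠ 0`), the places `k₁ ≠ k₂` unbalanced
  with `n_{μ k₁} + n_{μ k₂} = 2` (the `K`-signature `(3,3)` along `μ`), and `μ` THE `K`-FIBRE: `W_{μ k} ⊆ W_K = ker(φ^*_ℂ − i√d)`,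
  `W_{μ̄ k} ⊆ W̄_K`. CONCLUSION (`hSU_E` verbatim, for every polarization `ψ` of `H¹(A(ℂ); ℚ)`): every operator on `H¹(A;ℂ)`
  commuting with `φ^*_ℂ` and `φ_{E,ℂ}^*`, skew for `ψ_ℂ` and traceless on `W_K` lies in `Lie Hg(H¹A) ⊗ ℂ`.
  PROOF: eng-5 g6's AV → Hodge dictionary (`AbelianVariety.hodgeLieC_of_cmField_oneBalancedPlace`, copied: `End_Hdg = ℚ[φ_E^*]`,
  division, multiplicities, `htop`) + `φ^*` is `ψ`-skew (its adjoint acts on `W_{μ k}` by `−i√d`, duality of the adapted basis)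
  + `tr(Y | W_K) = Σ_k tr(Y | W_{μ k})` (adapted basis of `W_K = ⊕_k W_{μ k}`) + the Hodge-structure theorem.
Plugged into the socket (p698115) it discharges the displayed `hG` of the census rows for EVERY row-13 member.

## References
* [MoonenZarhin1998WeilClasses] B. Moonen, Yu. Zarhin, J. reine angew. Math. 496 (1998), Criterion (crit1), §4 Remark (1)–(2).
* [MoonenZarhin1999LowDim] B. Moonen, Yu. Zarhin, Math. Ann. 315 (1999), §2 (2.3).
* [Ribet1983] K. A. Ribet, Amer. J. Math. 105 (1983), Thm. 0.
* [vanGeemen1994HodgeAV] B. van Geemen, LNM 1594 (1994), 4.9 and 6.9.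
* [MumfordAV1970] D. Mumford, Abelian varieties (1970), §19 Cor. 2 of Thm. 1 (p. 174).
-/

noncomputable section

open scoped TensorProduct Matrix
open CategoryTheory Module

namespace Literature.AlgebraicGeometry.HodgeTheory

open Literature.AlgebraicTopology.SingularHomology
open Literature.AlgebraicGeometry.Motives (IsSmoothProjective AbelianVariety bettiCohomology HodgeTensorFacts
  hodgeTensorFacts_holds)
open Literature.AlgebraicGeometry.Motives.HodgeStructure
open Literature.AlgebraicGeometry.ComplexMultiplication (bettiRep bettiRep_of)

variable {ι : Type} [Fintype ι] [DecidableEq ι] {A : AbelianVariety ℂ} {φ : A ⟶ A} {d : ℕ}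

/-- The two elements of `Fin 2`. [folklore] -/
private theorem fin2_cases₆ (r : Fin 2) : r = 0 ∨ r = 1 := by
  fin_cases r <;> simp

/-- **ROW 13 LIE THEOREM: `Lie Hg(H¹A) ⊗ ℂ ⊇ (𝔲_E ∩ 𝔰𝔲_K) ⊗ ℂ` FOR EVERY SIMPLE WEIL-TYPE SIXFOLD WITH `End⁰ = E ⊋ K` SEXTIC CM
OF PATTERN `(2,2,1)`** (see the module docstring), in the verbatim shape of the displayed `hSU_E` of the `E ⊋ K` socket.
[cite: MoonenZarhin1998WeilClasses, §4 Remark (1)] [cite: MoonenZarhin1999LowDim, §2 (2.3)] [cite: Ribet1983, Thm. 0]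
[cite: vanGeemen1994HodgeAV, 4.9] [cite: MumfordAV1970, §19 Cor. 2 of Thm. 1 (p. 174)] -/
theorem IsWeilType.mem_hodgeLieC_of_commute_of_skew_of_trace_of_cmField [HodgeTensorFacts.{0, 0}] (hι : Fintype.card ι ≤ 3)
    (hW : IsWeilType A φ 3 d) (hAs : A.IsSimple) (φE : A ⟶ A) (hE : Module.finrank ℚ A.endAlgebra = 2 * Fintype.card ι)
    (μ : ι → ℂ) (hinj : Function.Injective μ) (hdist : ∀ k k', μ k' ≠ starRingEnd ℂ (μ k))
    (hmult : ∀ k, eigenMultiplicity A φE (μ k) + eigenMultiplicity A φE (starRingEnd ℂ (μ k)) = 2)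
    (k₀ : ι) (hk₀ : eigenMultiplicity A φE (μ k₀) ≠ 0 ∧ eigenMultiplicity A φE (starRingEnd ℂ (μ k₀)) ≠ 0)
    (hunb : ∀ k, k ≠ k₀ → eigenMultiplicity A φE (μ k) = 0 ∨ eigenMultiplicity A φE (starRingEnd ℂ (μ k)) = 0)
    (k₁ k₂ : ι) (hk₁₂ : k₁ ≠ k₂) (hk₁ : k₁ ≠ k₀) (hk₂ : k₂ ≠ k₀)
    (hKW : eigenMultiplicity A φE (μ k₁) + eigenMultiplicity A φE (μ k₂) = 2)
    (hKE : ∀ k, Module.End.eigenspace (((bettiCohomology.map φE.hom.hom.hom 1).hom).baseChange ℂ) (μ k) ≤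
      Module.End.eigenspace (((bettiCohomology.map φ.hom.hom.hom 1).hom).baseChange ℂ) (Complex.I * (Real.sqrt d : ℂ)))
    (hKE' : ∀ k, Module.End.eigenspace (((bettiCohomology.map φE.hom.hom.hom 1).hom).baseChange ℂ) (starRingEnd ℂ (μ k)) ≤
      Module.End.eigenspace (((bettiCohomology.map φ.hom.hom.hom 1).hom).baseChange ℂ) (-(Complex.I * (Real.sqrt d : ℂ))))
    (ψ : (BettiUniverse.hodge exists_isReal_hodgeModel_holds (AbelianVariety.isSmoothProjective_holds (A := A)) 1).Polarization) :
    ∀ (Y : Module.End ℂ (ℂ ⊗[ℚ] bettiCohomology A.X 1))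
      (hYφ : Y * ((bettiCohomology.map φ.hom.hom.hom 1).hom).baseChange ℂ =
        ((bettiCohomology.map φ.hom.hom.hom 1).hom).baseChange ℂ * Y),
      Y * ((bettiCohomology.map φE.hom.hom.hom 1).hom).baseChange ℂ =
        ((bettiCohomology.map φE.hom.hom.hom 1).hom).baseChange ℂ * Y →
      (∀ x y, ψ.form.baseChange ℂ (Y x) y + ψ.form.baseChange ℂ x (Y y) = 0) →
      LinearMap.trace ℂ _ (Y.restrict fun x (hx : x ∈ Module.End.eigenspace
          (((bettiCohomology.map φ.hom.hom.hom 1).hom).baseChange ℂ) (Complex.I * (Real.sqrt d : ℂ))) =>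
        UnitaryTheta.apply_mem_eigenspace_of_commute hYφ hx) = 0 →
      Y ∈ (BettiUniverse.hodge exists_isReal_hodgeModel_holds (AbelianVariety.isSmoothProjective_holds (A := A)) 1).hodgeLieC := by
  classical
  intro Y hYφ hYφE hYskew htrK
  have hHD : exists_isReal_hodgeModel := exists_isReal_hodgeModel_holds
  have hI : hodgePQ_independent_of_hodgeModel := hodgePQ_independent_of_hodgeModel_holds
  haveI : Module.Finite ℚ (bettiCohomology A.X 1) := finite_bettiCohomology_one A
  have hX : IsSmoothProjective A.dim A.X := AbelianVariety.isSmoothProjective_holds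
  have heff := BettiUniverse.hodge_isEffective hHD hX 1
  -- `|ι| = 3`, `dim A = 6 = |ι| · 2`
  have hcard3 : Fintype.card ι = 3 := by
    apply le_antisymm hι
    have h := Finset.card_le_univ ({k₁, k₂, k₀} : Finset ι)
    rwa [Finset.card_insert_of_notMem (by simp [hk₁₂, hk₁]), Finset.card_insert_of_notMem (by simp [hk₂]),
      Finset.card_singleton] at h
  have hdim : A.dim = Fintype.card ι * 2 := by rw [hW.dim_eq, hcard3]
  -- the rational data `φ_E^*_ℚ` (the CM generator) and `φ^*_ℚ` (the `K`-operator)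
  set φQ : Module.End ℚ (bettiCohomology A.X 1) := (bettiCohomology.map φE.hom.hom.hom 1).hom with hφQ
  set φK : Module.End ℚ (bettiCohomology A.X 1) := (bettiCohomology.map φ.hom.hom.hom 1).hom with hφK
  set μK : ℂ := Complex.I * (Real.sqrt d : ℂ) with hμKdef
  have hμK0 : μK ≠ 0 := mul_ne_zero Complex.I_ne_zero
    (Complex.ofReal_ne_zero.2 (Real.sqrt_ne_zero'.2 (Nat.cast_pos.2 hW.d_pos)))
  have hφE' : φQ ∈ (BettiUniverse.hodge hHD (AbelianVariety.isSmoothProjective_holds (A := A)) 1).endAlg := by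
    have h := unop_bettiRep_mem_endAlg hHD hI (AbelianVariety.endAlgebra.of A φE)
    rwa [bettiRep_of, MulOpposite.unop_op] at h
  have hφKE : φK ∈ (BettiUniverse.hodge hHD (AbelianVariety.isSmoothProjective_holds (A := A)) 1).endAlg := by
    have h := unop_bettiRep_mem_endAlg hHD hI (AbelianVariety.endAlgebra.of A φ)
    rwa [bettiRep_of, MulOpposite.unop_op] at h
  have hVC : Module.finrank ℂ (ℂ ⊗[ℚ] bettiCohomology A.X 1) = Fintype.card (ι × Fin 2) * 2 := by
    rw [Module.finrank_baseChange, finrank_bettiCohomology_one A, hdim, Fintype.card_prod, Fintype.card_fin]; ring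
  -- the `2|ι|` eigenvalues, pairwise distinct
  set ev : ι × Fin 2 → ℂ := fun kt => if kt.2 = 0 then μ kt.1 else starRingEnd ℂ (μ kt.1) with hevdef
  have hev0 : ∀ k, ev (k, 0) = μ k := fun k => by simp [hevdef]
  have hev1 : ∀ k, ev (k, 1) = starRingEnd ℂ (μ k) := fun k => by simp [hevdef]
  have hev : Function.Injective ev := by
    rintro ⟨k, t⟩ ⟨k', t'⟩ h
    rcases fin2_cases₆ t with rfl | rfl <;> rcases fin2_cases₆ t' with rfl | rfl
    · rw [hev0, hev0] at h; rw [hinj h]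
    · rw [hev0, hev1] at h; exact absurd h (hdist k' k)
    · rw [hev1, hev0] at h; exact absurd h.symm (hdist k k')
    · rw [hev1, hev1] at h; rw [hinj ((starRingEnd ℂ).injective h)]
  -- the multiplicity dictionary
  have hgr := fun cc => CMTheta.finrank_eigenspace_eq_add
    (BettiUniverse.hodge hHD (AbelianVariety.isSmoothProjective_holds (A := A)) 1) Nat.cast_one heff hφE' cc
  have h10 : ∀ cc, Module.finrank ℂ ↥(Module.End.eigenspace (φQ.baseChange ℂ) cc ⊓
      (BettiUniverse.hodge hHD (AbelianVariety.isSmoothProjective_holds (A := A)) 1).piece 1 0) =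
        eigenMultiplicity A φE cc := fun cc => by
    rw [hφQ, finrank_eigenspace_inf_piece_oneZero_eq_eigenMultiplicity hHD hI φE cc]
  have h01 : ∀ cc, Module.finrank ℂ ↥(Module.End.eigenspace (φQ.baseChange ℂ) cc ⊓
      (BettiUniverse.hodge hHD (AbelianVariety.isSmoothProjective_holds (A := A)) 1).piece 0 1) =
        eigenMultiplicity A φE (starRingEnd ℂ cc) := fun cc => by
    rw [hφQ, finrank_eigenspace_inf_piece_zeroOne_eq_eigenMultiplicity_conj hHD hI φE cc]
  have hfin : ∀ kt, Module.finrank ℂ ↥(Module.End.eigenspace (φQ.baseChange ℂ) (ev kt)) = 2 := by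
    rintro ⟨k, t⟩
    rw [hgr, h10, h01]
    rcases fin2_cases₆ t with rfl | rfl
    · rw [hev0]; exact hmult k
    · rw [hev1, starRingEnd_self_apply, add_comm]; exact hmult k
  have hWne : ∀ kt, Module.End.eigenspace (φQ.baseChange ℂ) (ev kt) ≠ ⊥ := by
    intro kt hkt
    have h := hfin kt
    rw [hkt, finrank_bot] at h
    omega
  -- `End_Hdg = ℚ[φ_E^*]`
  have hcard : Fintype.card (ι × Fin 2) = 2 * Fintype.card ι := by rw [Fintype.card_prod, Fintype.card_fin, mul_comm]
  set e : ι × Fin 2 ≃ Fin (2 * Fintype.card ι) := Fintype.equivFinOfCardEq hcard with hedef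
  have hEφ := exists_eq_sum_smul_pow_bettiMapHom_fin hHD hI φE hE (ev ∘ e.symm) (hev.comp e.symm.injective)
    fun j => hWne (e.symm j)
  -- `hrank`, `htop`
  have hrank : ∀ k, Module.finrank ℂ ↥(Module.End.eigenspace (φQ.baseChange ℂ) (μ k) ⊓
      (BettiUniverse.hodge hHD (AbelianVariety.isSmoothProjective_holds (A := A)) 1).piece 1 0) +
      Module.finrank ℂ ↥(Module.End.eigenspace (φQ.baseChange ℂ) (μ k) ⊓
      (BettiUniverse.hodge hHD (AbelianVariety.isSmoothProjective_holds (A := A)) 1).piece 0 1) = 2 := fun k => by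
    rw [h10, h01]; exact hmult k
  have htop : (⨆ kt : ι × Fin 2, Module.End.eigenspace (φQ.baseChange ℂ) (ev kt)) = ⊤ := by
    have hind : iSupIndep fun kt => Module.End.eigenspace (φQ.baseChange ℂ) (ev kt) :=
      (Module.End.eigenspaces_iSupIndep (φQ.baseChange ℂ)).comp hev
    apply Submodule.eq_top_of_finrank_eq
    have h := Motives.finrank_biSup_eq_sum_of_iSupIndep hind Finset.univ
    have hs : (⨆ kt ∈ (Finset.univ : Finset (ι × Fin 2)), Module.End.eigenspace (φQ.baseChange ℂ) (ev kt)) =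
        ⨆ kt, Module.End.eigenspace (φQ.baseChange ℂ) (ev kt) := by simp
    rw [hs] at h
    rw [h, hVC, Finset.sum_congr rfl fun kt _ => hfin kt, Finset.sum_const, Finset.card_univ, smul_eq_mul]
  -- `dim_ℚ End_Hdg = 2|ι|` and the division property (`A` simple)
  have hEdim : Module.finrank ℚ (BettiUniverse.hodge hHD (AbelianVariety.isSmoothProjective_holds (A := A)) 1).endAlg =
      2 * Fintype.card ι := by
    rw [finrank_endAlg_hodge_one hHD hI, hE]
  have hdiv : ∀ a ∈ (BettiUniverse.hodge hHD (AbelianVariety.isSmoothProjective_holds (A := A)) 1).endAlg, a ≠ 0 →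
      ∃ b : Module.End ℚ (bettiCohomology A.X 1), b * a = 1 := by
    intro a ha ha0
    set x := (endAlgebraOpAlgEquivEndAlg (B := A) hHD hI).symm ⟨a, ha⟩ with hxdef
    have hx : ((endAlgebraOpAlgEquivEndAlg (B := A) hHD hI x :
        (BettiUniverse.hodge hHD (AbelianVariety.isSmoothProjective_holds (A := A)) 1).endAlg) :
        Module.End ℚ (bettiCohomology A.X 1)) = a := by
      rw [hxdef, AlgEquiv.apply_symm_apply]
    have hx0 : MulOpposite.unop x ≠ 0 := by
      intro h0
      have : x = 0 := MulOpposite.unop_injective (by rw [h0, MulOpposite.unop_zero])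
      apply ha0
      rw [← hx, this, map_zero]
      rfl
    obtain ⟨y, hxy, -⟩ :=
      Literature.AlgebraicGeometry.ComplexMultiplication.endAlgebra_exists_inv_of_isSimple hAs (MulOpposite.unop x) hx0
    refine ⟨((endAlgebraOpAlgEquivEndAlg (B := A) hHD hI (MulOpposite.op y) :
      (BettiUniverse.hodge hHD (AbelianVariety.isSmoothProjective_holds (A := A)) 1).endAlg) :
      Module.End ℚ (bettiCohomology A.X 1)), ?_⟩
    rw [← hx, ← Subalgebra.coe_mul, ← map_mul, ← MulOpposite.op_unop x, ← MulOpposite.op_mul, hxy,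
      MulOpposite.op_one, map_one, Subalgebra.coe_one]
  -- the pattern, in the Hodge dictionary
  have hk₀' : Module.finrank ℂ ↥(Module.End.eigenspace (φQ.baseChange ℂ) (μ k₀) ⊓
      (BettiUniverse.hodge hHD (AbelianVariety.isSmoothProjective_holds (A := A)) 1).piece 1 0) ≠ 0 ∧
      Module.finrank ℂ ↥(Module.End.eigenspace (φQ.baseChange ℂ) (μ k₀) ⊓
      (BettiUniverse.hodge hHD (AbelianVariety.isSmoothProjective_holds (A := A)) 1).piece 0 1) ≠ 0 := by
    rw [h10, h01]; exact hk₀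
  have hunb' : ∀ k, k ≠ k₀ → Module.finrank ℂ ↥(Module.End.eigenspace (φQ.baseChange ℂ) (μ k) ⊓
      (BettiUniverse.hodge hHD (AbelianVariety.isSmoothProjective_holds (A := A)) 1).piece 1 0) = 0 ∨
      Module.finrank ℂ ↥(Module.End.eigenspace (φQ.baseChange ℂ) (μ k) ⊓
      (BettiUniverse.hodge hHD (AbelianVariety.isSmoothProjective_holds (A := A)) 1).piece 0 1) = 0 := fun k hk => by
    rw [h10, h01]; exact hunb k hk
  have hKW' : Module.finrank ℂ ↥(Module.End.eigenspace (φQ.baseChange ℂ) (μ k₁) ⊓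
      (BettiUniverse.hodge hHD (AbelianVariety.isSmoothProjective_holds (A := A)) 1).piece 1 0) +
      Module.finrank ℂ ↥(Module.End.eigenspace (φQ.baseChange ℂ) (μ k₂) ⊓
      (BettiUniverse.hodge hHD (AbelianVariety.isSmoothProjective_holds (A := A)) 1).piece 1 0) = 2 := by
    rw [h10, h10]; exact hKW
  -- the `K`-datum on the blocks: `φ^*_ℂ = ±i√d` on `W_{μ k}` / `W_{μ̄ k}`
  have hKEv : ∀ k, ∀ w ∈ Module.End.eigenspace (φQ.baseChange ℂ) (μ k), φK.baseChange ℂ w = μK • w := fun k w hw =>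
    Module.End.mem_eigenspace_iff.1 (hKE k hw)
  have hKE'v : ∀ k, ∀ w ∈ Module.End.eigenspace (φQ.baseChange ℂ) (starRingEnd ℂ (μ k)), φK.baseChange ℂ w = (-μK) • w :=
    fun k w hw => Module.End.mem_eigenspace_iff.1 (hKE' k hw)
  -- `φ^*` is `ψ`-skew: its adjoint acts on `W_{μ k}` by `−i√d`
  obtain ⟨cb, κ, hcbW, hcbW', -, -, hdual, -⟩ := CMTheta.exists_adaptedDualBasis
    (BettiUniverse.hodge hHD (AbelianVariety.isSmoothProjective_holds (A := A)) 1) Nat.cast_one heff ψ hφE' hEφ μ hinj hdist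
    hrank htop
  have hadjE : ψ.adjoint φK ∈ (BettiUniverse.hodge hHD (AbelianVariety.isSmoothProjective_holds (A := A)) 1).endAlg :=
    ψ.adjoint_mem_endAlg hφKE
  choose s hs using fun k => CMTheta.exists_smul_of_mem_endAlg
    (BettiUniverse.hodge hHD (AbelianVariety.isSmoothProjective_holds (A := A)) 1) hEφ hadjE (μ k)
  have hs' : ∀ k, s k = -μK := fun k => by
    have h := ψ.form_baseChange_adjoint_left φK (cb ((k, 0), (0 : Fin 2))) (cb ((k, 1), (0 : Fin 2)))
    rw [hs k _ (hcbW k 0), hKE'v k _ (hcbW' k 0), map_smul, map_smul, LinearMap.smul_apply, smul_eq_mul, smul_eq_mul,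
      hdual, if_pos ⟨rfl, rfl⟩, mul_one, mul_one] at h
    exact h
  have hadj : ψ.adjoint φK = -φK := by
    have hsum0 : ψ.adjoint φK + φK = 0 := by
      by_contra hne
      obtain ⟨w, hw, hw0⟩ := (Submodule.ne_bot_iff _).1 (by rw [← hev0]; exact hWne (k₀, 0) :
        Module.End.eigenspace (φQ.baseChange ℂ) (μ k₀) ≠ ⊥)
      exact CMArith.apply_ne_zero (BettiUniverse.hodge hHD (AbelianVariety.isSmoothProjective_holds (A := A)) 1) hdiv
        (add_mem hadjE hφKE) hne hw0 (by
          rw [LinearMap.baseChange_add, LinearMap.add_apply, hs k₀ w hw, hs', hKEv k₀ w hw, neg_smul, neg_add_cancel])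
    exact eq_neg_of_add_eq_zero_left hsum0
  have hKskew : ∀ v w, ψ.form (φK v) w + ψ.form v (φK w) = 0 := fun v w => by
    have h := ψ.isAdjointPair_adjoint_left φK v w
    rw [hadj, LinearMap.neg_apply, map_neg, LinearMap.neg_apply] at h
    rw [← h, add_neg_cancel]
  -- `tr(Y | W_K) = Σ_k tr(Y | W_{μ k})`
  have hYW : ∀ k, ∀ w ∈ Module.End.eigenspace (φQ.baseChange ℂ) (μ k), Y w ∈ Module.End.eigenspace (φQ.baseChange ℂ) (μ k) :=
    fun k w hw => UnitaryTheta.apply_mem_eigenspace_of_commute hYφE hw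
  have hYWK : ∀ w ∈ Module.End.eigenspace (φK.baseChange ℂ) μK, Y w ∈ Module.End.eigenspace (φK.baseChange ℂ) μK :=
    fun w hw => UnitaryTheta.apply_mem_eigenspace_of_commute hYφ hw
  have he0 : ∀ k : ι, Function.Injective (fun j : Fin 2 => (((k, (0 : Fin 2)), j) : (ι × Fin 2) × Fin 2)) :=
    fun k j j' h => by simpa using h
  have htrk : ∀ k, LinearMap.trace ℂ _ (Y.restrict (hYW k)) = ∑ j, cb.repr (Y (cb ((k, 0), j))) ((k, 0), j) := fun k =>
    CMArith.trace_restrict_eq_sum_repr cb _ (he0 k) _ (hcbW k) (by rw [hgr, hrank k]) Y (hYW k)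
  -- a numbering of the letters of `W_K`
  set eι : Fin 3 ≃ ι := (Fintype.equivFinOfCardEq hcard3).symm with heι
  set eK : Fin (3 * 2) → (ι × Fin 2) × Fin 2 :=
    fun j => ((eι (finProdFinEquiv.symm j).1, 0), (finProdFinEquiv.symm j).2) with heK
  have heKinj : Function.Injective eK := by
    intro j j' h
    simp only [heK, Prod.mk.injEq] at h
    exact finProdFinEquiv.symm.injective (Prod.ext (eι.injective h.1.1) h.2)
  have hconj : starRingEnd ℂ μK = -μK := by
    rw [hμKdef, map_mul, Complex.conj_I, Complex.conj_ofReal, neg_mul]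
  have hfinK : Module.finrank ℂ ↥(Module.End.eigenspace (φK.baseChange ℂ) μK) = 3 * 2 := by
    rw [CMTheta.finrank_eigenspace_eq_add (BettiUniverse.hodge hHD (AbelianVariety.isSmoothProjective_holds (A := A)) 1)
      Nat.cast_one heff hφKE, hφK, finrank_eigenspace_inf_piece_oneZero_eq_eigenMultiplicity hHD hI φ,
      finrank_eigenspace_inf_piece_zeroOne_eq_eigenMultiplicity_conj hHD hI φ, hμKdef, hW.eigenMultiplicity_eq, hconj,
      hW.eigenMultiplicity_neg_eq]
  have htrKsum : LinearMap.trace ℂ _ (Y.restrict hYWK) = ∑ j, cb.repr (Y (cb (eK j))) (eK j) :=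
    CMArith.trace_restrict_eq_sum_repr cb _ heKinj _ (fun j => hKE _ (hcbW _ _)) hfinK Y hYWK
  have hsplit : ∑ j, cb.repr (Y (cb (eK j))) (eK j) = ∑ k, ∑ j : Fin 2, cb.repr (Y (cb ((k, 0), j))) ((k, 0), j) := by
    have h1 : ∑ j, cb.repr (Y (cb (eK j))) (eK j) =
        ∑ p : Fin 3 × Fin 2, cb.repr (Y (cb ((eι p.1, 0), p.2))) ((eι p.1, 0), p.2) := by
      rw [← finProdFinEquiv.symm.sum_comp]
    rw [h1, Fintype.sum_prod_type]
    exact eι.sum_comp (fun k => ∑ j : Fin 2, cb.repr (Y (cb ((k, 0), j))) ((k, 0), j))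
  have htr : ∑ k, LinearMap.trace ℂ _ (Y.restrict fun x (hx : x ∈ Module.End.eigenspace (φQ.baseChange ℂ) (μ k)) =>
      UnitaryTheta.apply_mem_eigenspace_of_commute hYφE hx) = 0 := by
    have h : ∑ k, LinearMap.trace ℂ _ (Y.restrict (hYW k)) = 0 := by
      rw [Finset.sum_congr rfl fun k _ => htrk k, ← hsplit, ← htrKsum]
      exact htrK
    exact h
  exact CMThetaOneBalancedKWeil.mem_hodgeLieC_of_commute_of_skew_of_traces hι
    (BettiUniverse.hodge hHD (AbelianVariety.isSmoothProjective_holds (A := A)) 1) Nat.cast_one heff ψ hφE' hEφ hEdim hdiv μ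
    hinj hdist hrank htop k₀ hk₀' hunb' k₁ k₂ hk₁₂ hk₁ hk₂ hKW' hφKE hKskew hμK0 hKEv hYφE hYskew htr

end Literature.AlgebraicGeometry.HodgeTheory
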